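import Summits.ValiantsHypothesis.ValiantsHypothesis.Theorems.PolyaContinuedMonotoneCoverHardFiberLanes
import Literature.Computability.AlgebraicComplexity.PermanentCompleteness

/-!
# Crux `MonotoneCoverHard` (stmt-ValiantsHypothesis-7421), width line — TRANSPOSES of a cover and the
column-vertex / label-column versions of the lane theorems

(val-width-7421-p4 g0, 2026-08-28; director's ask "column-vertex transpose".)

The three hypotheses of a label-bijective Pfaffian cover `(m, E, a)` of `per_n` — Pfaffian `E` in the
route's symbolic form, labels in `{X j, 0, 1}`, `per_n = aeval a PM_E` — are invariant under

* `cover_vertexTranspose` — the VERTEX TRANSPOSE `E ↦ Eᵀ = {(j,i) : (i,j) ∈ E}`, `a ↦ a ∘ swap`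
  (weight-nonzero perfect matchings `τ ↦ τ⁻¹`): `det` / `permanent` of the transposed symbolic
  matrices are the `rename Prod.swap`-images of the original ones;
* `cover_labelTranspose` — the LABEL TRANSPOSE `a ↦ rename Prod.swap ∘ a` (`x_{kl} ↦ x_{lk}`), since
  `rename Prod.swap` fixes the generic permanent (`perPoly_rename_swap`).

Consequently every "row / label-row" structural theorem of the lane has a column / label-column twin;
recorded here for the lane-set theorem of `…FiberLanes.lean`:
`no_colLaneSet_pfaffian_cover` (a set of COLUMN vertices receiving exactly the label-rows `T`,
`#T ≥ 3`, in every weight-nonzero perfect matching is impossible), `no_laneSet_labelCol_pfaffian_cover`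
(rows carrying exactly the label-COLUMNS `T`), `no_colLaneSet_labelCol_pfaffian_cover`.
VP ≠ VNP is not moved; `MonotoneCoverHard` stays open.  No definitions.
-/

namespace Summit.ValiantsHypothesis.ValiantsHypothesis.Theorems.PolyaContinuedMonotoneCoverHard

-- summit = sub-problem name (single-conjunct summit, D-0017 layout), so the namespace repeats it
set_option linter.dupNamespace false

open scoped Classical
open Finset
open Literature.Computability.AlgebraicComplexity (perPoly)

/-- `rename Prod.swap` (transposing the variable matrix) fixes the generic permanent
(cf. `rename_swap_perPoly` in the LiftWidthPerFour files; reproved to keep imports light). -/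
theorem perPoly_rename_swap (n : ℕ) :
    MvPolynomial.rename Prod.swap (perPoly (Fin n) ℂ) = perPoly (Fin n) ℂ := by
  unfold perPoly
  rw [← AlgHom.coe_toRingHom, ← Matrix.permanent_map_ringHom, ← Matrix.permanent_transpose]
  congr 1
  ext i j
  simp [Matrix.mvPolynomialX]

/-- **Vertex transpose of a cover.**  If `(m, E, a)` is a cover of `per_n` with Pfaffian `E` (symbolic
form) and labels in `{X j, 0, 1}`, then so is `(m, Eᵀ, a ∘ swap)` with
`Eᵀ = E.map (Equiv.prodComm _ _)`. -/
theorem cover_vertexTranspose (n m : ℕ) (E : Finset (Fin m × Fin m))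
    (a : Fin m × Fin m → MvPolynomial (Fin n × Fin n) ℂ)
    (hsig : ∃ s : Fin m × Fin m → ℂ, (∀ e, s e = 1 ∨ s e = -1) ∧
      (Matrix.of fun i j => if (i, j) ∈ E then MvPolynomial.C (s (i, j)) * MvPolynomial.X (i, j)
          else 0 : Matrix (Fin m) (Fin m) (MvPolynomial (Fin m × Fin m) ℂ)).det =
        (Matrix.of fun i j => if (i, j) ∈ E then MvPolynomial.X (i, j) else 0 :
          Matrix (Fin m) (Fin m) (MvPolynomial (Fin m × Fin m) ℂ)).permanent)
    (ha : ∀ e, (∃ j, a e = MvPolynomial.X j) ∨ a e = 0 ∨ a e = 1)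
    (hper : perPoly (Fin n) ℂ =
      MvPolynomial.aeval a (Matrix.of fun i j => if (i, j) ∈ E then MvPolynomial.X (i, j) else 0 :
          Matrix (Fin m) (Fin m) (MvPolynomial (Fin m × Fin m) ℂ)).permanent) :
    (∃ s : Fin m × Fin m → ℂ, (∀ e, s e = 1 ∨ s e = -1) ∧
      (Matrix.of fun i j => if (i, j) ∈ E.map (Equiv.prodComm (Fin m) (Fin m)).toEmbedding then
          MvPolynomial.C (s (i, j)) * MvPolynomial.X (i, j)
          else 0 : Matrix (Fin m) (Fin m) (MvPolynomial (Fin m × Fin m) ℂ)).det =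
        (Matrix.of fun i j => if (i, j) ∈ E.map (Equiv.prodComm (Fin m) (Fin m)).toEmbedding then
            MvPolynomial.X (i, j) else 0 :
          Matrix (Fin m) (Fin m) (MvPolynomial (Fin m × Fin m) ℂ)).permanent) ∧
    (∀ e, (∃ j, (fun e : Fin m × Fin m => a e.swap) e = MvPolynomial.X j) ∨
      (fun e : Fin m × Fin m => a e.swap) e = 0 ∨ (fun e : Fin m × Fin m => a e.swap) e = 1) ∧
    perPoly (Fin n) ℂ =
      MvPolynomial.aeval (fun e : Fin m × Fin m => a e.swap) (Matrix.of fun i j =>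
          if (i, j) ∈ E.map (Equiv.prodComm (Fin m) (Fin m)).toEmbedding then MvPolynomial.X (i, j)
          else 0 : Matrix (Fin m) (Fin m) (MvPolynomial (Fin m × Fin m) ℂ)).permanent := by
  set E' := E.map (Equiv.prodComm (Fin m) (Fin m)).toEmbedding with hE'
  have hmem : ∀ i j, (i, j) ∈ E' ↔ (j, i) ∈ E := by
    intro i j
    rw [hE', Finset.mem_map_equiv]
    rfl
  set φ : MvPolynomial (Fin m × Fin m) ℂ →ₐ[ℂ] MvPolynomial (Fin m × Fin m) ℂ :=
    MvPolynomial.rename Prod.swap with hφ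
  -- the transposed symbolic matrices are renamed transposes
  have hPM : (Matrix.of fun i j => if (i, j) ∈ E' then MvPolynomial.X (i, j) else 0 :
        Matrix (Fin m) (Fin m) (MvPolynomial (Fin m × Fin m) ℂ)) =
      ((φ : MvPolynomial (Fin m × Fin m) ℂ →+* MvPolynomial (Fin m × Fin m) ℂ).mapMatrix
        (Matrix.of fun i j => if (i, j) ∈ E then MvPolynomial.X (i, j) else 0 :
          Matrix (Fin m) (Fin m) (MvPolynomial (Fin m × Fin m) ℂ))).transpose := by
    ext i j
    simp only [Matrix.of_apply, Matrix.transpose_apply, RingHom.mapMatrix_apply, Matrix.map_apply,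
      hmem]
    split_ifs with h
    · rw [AlgHom.coe_toRingHom, hφ, MvPolynomial.rename_X]; rfl
    · rw [map_zero]
  refine ⟨?_, ?_, ?_⟩
  · obtain ⟨s, hs, hdet⟩ := hsig
    refine ⟨fun e => s e.swap, fun e => hs e.swap, ?_⟩
    have hS : (Matrix.of fun i j => if (i, j) ∈ E' then
          MvPolynomial.C (s (i, j).swap) * MvPolynomial.X (i, j) else 0 :
          Matrix (Fin m) (Fin m) (MvPolynomial (Fin m × Fin m) ℂ)) =
        ((φ : MvPolynomial (Fin m × Fin m) ℂ →+* MvPolynomial (Fin m × Fin m) ℂ).mapMatrix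
          (Matrix.of fun i j => if (i, j) ∈ E then
              MvPolynomial.C (s (i, j)) * MvPolynomial.X (i, j) else 0 :
            Matrix (Fin m) (Fin m) (MvPolynomial (Fin m × Fin m) ℂ))).transpose := by
      ext i j
      simp only [Matrix.of_apply, Matrix.transpose_apply, RingHom.mapMatrix_apply, Matrix.map_apply,
        hmem, Prod.swap_prod_mk]
      split_ifs with h
      · rw [AlgHom.coe_toRingHom, map_mul, hφ, MvPolynomial.rename_X, MvPolynomial.rename_C]; rfl
      · rw [map_zero]
    have hS' : (Matrix.of fun i j => if (i, j) ∈ E' then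
          MvPolynomial.C ((fun e : Fin m × Fin m => s e.swap) (i, j)) * MvPolynomial.X (i, j) else 0 :
          Matrix (Fin m) (Fin m) (MvPolynomial (Fin m × Fin m) ℂ)) =
        (Matrix.of fun i j => if (i, j) ∈ E' then
          MvPolynomial.C (s (i, j).swap) * MvPolynomial.X (i, j) else 0 :
          Matrix (Fin m) (Fin m) (MvPolynomial (Fin m × Fin m) ℂ)) := rfl
    rw [hS', hS, hPM, Matrix.det_transpose, Matrix.permanent_transpose, ← RingHom.map_det,
      RingHom.mapMatrix_apply, Matrix.permanent_map_ringHom, hdet]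
  · intro e
    rcases ha e.swap with ⟨j, hj⟩ | h | h
    · exact Or.inl ⟨j, hj⟩
    · exact Or.inr (Or.inl h)
    · exact Or.inr (Or.inr h)
  · rw [hPM, Matrix.permanent_transpose, RingHom.mapMatrix_apply, Matrix.permanent_map_ringHom,
      AlgHom.coe_toRingHom, hφ, MvPolynomial.aeval_rename, hper]
    congr 1

/-- Under the vertex transpose the weight-nonzero perfect matchings are the inverses of the original
ones. -/
theorem good_vertexTranspose_iff {n m : ℕ} (E : Finset (Fin m × Fin m))
    (a : Fin m × Fin m → MvPolynomial (Fin n × Fin n) ℂ) (τ : Equiv.Perm (Fin m)) :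
    (∀ i, (i, τ i) ∈ E.map (Equiv.prodComm (Fin m) (Fin m)).toEmbedding ∧
        (fun e : Fin m × Fin m => a e.swap) (i, τ i) ≠ 0) ↔
      ∀ i, (i, τ.symm i) ∈ E ∧ a (i, τ.symm i) ≠ 0 := by
  have hmem : ∀ i j, (i, j) ∈ E.map (Equiv.prodComm (Fin m) (Fin m)).toEmbedding ↔ (j, i) ∈ E := by
    intro i j
    rw [Finset.mem_map_equiv]
    rfl
  constructor
  · intro h i
    have h1 := h (τ.symm i)
    rw [Equiv.apply_symm_apply, hmem] at h1
    exact h1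
  · intro h i
    have h1 := h (τ i)
    rw [Equiv.symm_apply_apply] at h1
    rw [hmem]
    exact h1

/-- **Label transpose of a cover.**  If `(m, E, a)` is a cover of `per_n` with labels in
`{X j, 0, 1}`, then so is `(m, E, rename Prod.swap ∘ a)` (labels `x_{kl} ↦ x_{lk}`); the edge set, hence
the Pfaffian hypothesis and the weight-nonzero perfect matchings, are unchanged. -/
theorem cover_labelTranspose (n m : ℕ) (E : Finset (Fin m × Fin m))
    (a : Fin m × Fin m → MvPolynomial (Fin n × Fin n) ℂ)
    (ha : ∀ e, (∃ j, a e = MvPolynomial.X j) ∨ a e = 0 ∨ a e = 1)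
    (hper : perPoly (Fin n) ℂ =
      MvPolynomial.aeval a (Matrix.of fun i j => if (i, j) ∈ E then MvPolynomial.X (i, j) else 0 :
          Matrix (Fin m) (Fin m) (MvPolynomial (Fin m × Fin m) ℂ)).permanent) :
    (∀ e, (∃ j, (fun e => MvPolynomial.rename Prod.swap (a e)) e = MvPolynomial.X j) ∨
      (fun e => MvPolynomial.rename Prod.swap (a e)) e = 0 ∨
      (fun e => MvPolynomial.rename Prod.swap (a e)) e = 1) ∧
    perPoly (Fin n) ℂ =
      MvPolynomial.aeval (fun e => MvPolynomial.rename Prod.swap (a e)) (Matrix.of fun i j =>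
          if (i, j) ∈ E then MvPolynomial.X (i, j) else 0 :
          Matrix (Fin m) (Fin m) (MvPolynomial (Fin m × Fin m) ℂ)).permanent ∧
    (∀ e (v : Fin n × Fin n), a e = MvPolynomial.X v ↔
      (fun e => MvPolynomial.rename Prod.swap (a e)) e = MvPolynomial.X v.swap) ∧
    (∀ e, a e ≠ 0 ↔ (fun e => MvPolynomial.rename Prod.swap (a e)) e ≠ 0) := by
  have hinj : Function.Injective
      (MvPolynomial.rename (Prod.swap : Fin n × Fin n → Fin n × Fin n) :
        MvPolynomial (Fin n × Fin n) ℂ → MvPolynomial (Fin n × Fin n) ℂ) :=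
    MvPolynomial.rename_injective _ Prod.swap_injective
  refine ⟨fun e => ?_, ?_, fun e v => ?_, fun e => ?_⟩
  · rcases ha e with ⟨j, hj⟩ | h | h
    · refine Or.inl ⟨j.swap, ?_⟩
      simp only [hj, MvPolynomial.rename_X]
    · right; left
      simp only [h, map_zero]
    · right; right
      simp only [h, map_one]
  · rw [← MvPolynomial.comp_aeval, AlgHom.comp_apply, ← hper, perPoly_rename_swap]
  · constructor
    · intro h
      simp only [h, MvPolynomial.rename_X]
    · intro h
      apply hinj
      rw [MvPolynomial.rename_X]
      exact h
  · simp only [ne_eq]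
    rw [← (MvPolynomial.rename Prod.swap).map_zero]
    exact not_congr hinj.eq_iff.symm

/-- **Column lanes are impossible.**  No label-bijective Pfaffian cover of `per_n` has a set `C` of
column vertices and a set `T` of `≥ 3` label-rows such that in every weight-nonzero perfect matching
the edges into `C` are exactly the edges carrying a variable with label-row in `T`. -/
theorem no_colLaneSet_pfaffian_cover (n m : ℕ) (E : Finset (Fin m × Fin m))
    (a : Fin m × Fin m → MvPolynomial (Fin n × Fin n) ℂ)
    (hsig : ∃ s : Fin m × Fin m → ℂ, (∀ e, s e = 1 ∨ s e = -1) ∧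
      (Matrix.of fun i j => if (i, j) ∈ E then MvPolynomial.C (s (i, j)) * MvPolynomial.X (i, j)
          else 0 : Matrix (Fin m) (Fin m) (MvPolynomial (Fin m × Fin m) ℂ)).det =
        (Matrix.of fun i j => if (i, j) ∈ E then MvPolynomial.X (i, j) else 0 :
          Matrix (Fin m) (Fin m) (MvPolynomial (Fin m × Fin m) ℂ)).permanent)
    (ha : ∀ e, (∃ j, a e = MvPolynomial.X j) ∨ a e = 0 ∨ a e = 1)
    (hper : perPoly (Fin n) ℂ =
      MvPolynomial.aeval a (Matrix.of fun i j => if (i, j) ∈ E then MvPolynomial.X (i, j) else 0 :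
          Matrix (Fin m) (Fin m) (MvPolynomial (Fin m × Fin m) ℂ)).permanent)
    (C : Finset (Fin m)) (T : Finset (Fin n)) (hT3 : 3 ≤ T.card)
    (hCT : ∀ τ : Equiv.Perm (Fin m), (∀ i, (i, τ i) ∈ E ∧ a (i, τ i) ≠ 0) → ∀ i,
      τ i ∈ C ↔ ∃ v : Fin n × Fin n, a (i, τ i) = MvPolynomial.X v ∧ v.1 ∈ T) : False := by
  obtain ⟨hsig', ha', hper'⟩ := cover_vertexTranspose n m E a hsig ha hper
  refine no_laneSet_pfaffian_cover n m _ _ hsig' ha' hper' C T hT3 fun τ hτ i => ?_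
  have hτs := (good_vertexTranspose_iff E a τ).1 hτ
  have h := hCT τ.symm hτs (τ i)
  rw [Equiv.symm_apply_apply] at h
  exact h

/-- **Lanes carrying a fixed set of ≥ 3 label-COLUMNS are impossible.** -/
theorem no_laneSet_labelCol_pfaffian_cover (n m : ℕ) (E : Finset (Fin m × Fin m))
    (a : Fin m × Fin m → MvPolynomial (Fin n × Fin n) ℂ)
    (hsig : ∃ s : Fin m × Fin m → ℂ, (∀ e, s e = 1 ∨ s e = -1) ∧
      (Matrix.of fun i j => if (i, j) ∈ E then MvPolynomial.C (s (i, j)) * MvPolynomial.X (i, j)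
          else 0 : Matrix (Fin m) (Fin m) (MvPolynomial (Fin m × Fin m) ℂ)).det =
        (Matrix.of fun i j => if (i, j) ∈ E then MvPolynomial.X (i, j) else 0 :
          Matrix (Fin m) (Fin m) (MvPolynomial (Fin m × Fin m) ℂ)).permanent)
    (ha : ∀ e, (∃ j, a e = MvPolynomial.X j) ∨ a e = 0 ∨ a e = 1)
    (hper : perPoly (Fin n) ℂ =
      MvPolynomial.aeval a (Matrix.of fun i j => if (i, j) ∈ E then MvPolynomial.X (i, j) else 0 :
          Matrix (Fin m) (Fin m) (MvPolynomial (Fin m × Fin m) ℂ)).permanent)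
    (R : Finset (Fin m)) (T : Finset (Fin n)) (hT3 : 3 ≤ T.card)
    (hRT : ∀ τ : Equiv.Perm (Fin m), (∀ i, (i, τ i) ∈ E ∧ a (i, τ i) ≠ 0) → ∀ i,
      i ∈ R ↔ ∃ v : Fin n × Fin n, a (i, τ i) = MvPolynomial.X v ∧ v.2 ∈ T) : False := by
  obtain ⟨ha', hper', hX, hne⟩ := cover_labelTranspose n m E a ha hper
  refine no_laneSet_pfaffian_cover n m E _ hsig ha' hper' R T hT3 fun τ hτ i => ?_
  have hτ0 : ∀ i, (i, τ i) ∈ E ∧ a (i, τ i) ≠ 0 := fun i => ⟨(hτ i).1, (hne _).2 (hτ i).2⟩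
  rw [hRT τ hτ0 i]
  constructor
  · rintro ⟨v, hv, hvT⟩
    exact ⟨v.swap, (hX _ v).1 hv, hvT⟩
  · rintro ⟨w, hw, hwT⟩
    refine ⟨w.swap, (hX _ w.swap).2 ?_, hwT⟩
    rw [Prod.swap_swap]
    exact hw

/-- **Column lanes receiving a fixed set of ≥ 3 label-columns are impossible.** -/
theorem no_colLaneSet_labelCol_pfaffian_cover (n m : ℕ) (E : Finset (Fin m × Fin m))
    (a : Fin m × Fin m → MvPolynomial (Fin n × Fin n) ℂ)
    (hsig : ∃ s : Fin m × Fin m → ℂ, (∀ e, s e = 1 ∨ s e = -1) ∧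
      (Matrix.of fun i j => if (i, j) ∈ E then MvPolynomial.C (s (i, j)) * MvPolynomial.X (i, j)
          else 0 : Matrix (Fin m) (Fin m) (MvPolynomial (Fin m × Fin m) ℂ)).det =
        (Matrix.of fun i j => if (i, j) ∈ E then MvPolynomial.X (i, j) else 0 :
          Matrix (Fin m) (Fin m) (MvPolynomial (Fin m × Fin m) ℂ)).permanent)
    (ha : ∀ e, (∃ j, a e = MvPolynomial.X j) ∨ a e = 0 ∨ a e = 1)
    (hper : perPoly (Fin n) ℂ =
      MvPolynomial.aeval a (Matrix.of fun i j => if (i, j) ∈ E then MvPolynomial.X (i, j) else 0 :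
          Matrix (Fin m) (Fin m) (MvPolynomial (Fin m × Fin m) ℂ)).permanent)
    (C : Finset (Fin m)) (T : Finset (Fin n)) (hT3 : 3 ≤ T.card)
    (hCT : ∀ τ : Equiv.Perm (Fin m), (∀ i, (i, τ i) ∈ E ∧ a (i, τ i) ≠ 0) → ∀ i,
      τ i ∈ C ↔ ∃ v : Fin n × Fin n, a (i, τ i) = MvPolynomial.X v ∧ v.2 ∈ T) : False := by
  obtain ⟨ha', hper', hX, hne⟩ := cover_labelTranspose n m E a ha hper
  refine no_colLaneSet_pfaffian_cover n m E _ hsig ha' hper' C T hT3 fun τ hτ i => ?_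
  have hτ0 : ∀ i, (i, τ i) ∈ E ∧ a (i, τ i) ≠ 0 := fun i => ⟨(hτ i).1, (hne _).2 (hτ i).2⟩
  rw [hCT τ hτ0 i]
  constructor
  · rintro ⟨v, hv, hvT⟩
    exact ⟨v.swap, (hX _ v).1 hv, hvT⟩
  · rintro ⟨w, hw, hwT⟩
    refine ⟨w.swap, (hX _ w.swap).2 ?_, hwT⟩
    rw [Prod.swap_swap]
    exact hw

end Summit.ValiantsHypothesis.ValiantsHypothesis.Theorems.PolyaContinuedMonotoneCoverHard
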